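import Mathlib
import HarnessLib
import Literature.Probability.Percolation.StaticRenormalizationTwoArms
import Literature.Probability.Percolation.SharpnessDCTProofs

/-!
# Birth skeleton `block-cutset-duality` for the crux `FluxFromGoodBlocks`
(piece X_B of the strategist split of `FluxFromDensity`, route `PercFluxFromDensity`)

Bond percolation on `ℤ³` at an ARBITRARY `p`. The crux X_B: for an absolute `ε₀ > 0`, if
(h1) the core `Λ_L` misses the infinite cluster with probability `≤ ε₀` and (h2) the two-arm event at
scale `3L+1` (`u, v ∈ Λ_{3L+1}` joined to `∂Λ_{6L+2}` but not to each other inside `Λ_{6L+1}`) has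
probability `≤ ε₀`, then `E_p[MC_n] ≥ c(L) n² − C(L) n` for the expected maximal flow / minimal cut
of the cube `Λ_n` between its faces `{x₀ = ∓n}` (the route's layer-cake expression).

THE LINE (Grimmett 1999, proof of Thm. (7.68) p. 180, run at a SINGLE `p` with the Kesten–Zhang
blocks of §8.6 and with CUTSET duality in place of the sprinkled (2.46)): renormalised sites
`x ∈ ℤ³`, centres `c_x = (2L+1)x`, cores `c_x + Λ_L`; `x` is GOOD if some core vertex has an arm to
`∂(c_x + Λ_{8L+3})` and no two vertices of `c_x + Λ_{3L+1}` have two arms at radius `6L+2` around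
`c_x` (translates of the complements of h1/h2's events); boundary-layer sites are FINE if moreover a
core vertex is joined to the relevant face of `Λ_n` inside `Λ_n ∩ (c_x + Λ_{10L+4})`.
* STUB 1 `richCutsets` (probabilistic, the renormalisation proper): w.h.p. (`≥ 1/2`, `n ≥ n₀(L)`)
  EVERY block cutset of the block box `Λ_m`, `m = ⌊(n − 8L − 3)/(2L+1)⌋` (a set of sites meeting
  every lattice walk of `Λ_m` from `{x₀ = −m}` to `{x₀ = m}`) contains `≥ ⌈c n²⌉` fine sites —
  the fine/not-fine field is `11`-dependent with marginals `≥ 1 − 2ε₀ − 2ε₀^{1/6}` (square-root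
  trick for the face links), a block cutset meets every layer `{x₂ = j}` in a planar cutset, which
  contains a top–bottom `*`-chain of `≥ 2m+1` sites (site-crossing duality), and a `k`-dependent
  Peierls count makes every such chain at least half fine; no sprinkling, no Menger, no LSS needed;
* STUB 2 `cutsetTransfer` (deterministic): if every block cutset contains `≥ N` fine sites then every
  OPEN cutset `F` of `Λ_n` between the faces has `≥ N/8000` open edges — good neighbours glue
  (both cores' arm vertices have arms at radius `6L+2` around one centre, so no-two-arms joins them
  inside `c_x + Λ_{6L+1}`), fine ends reach the faces, so a walk of fine sites avoiding
  `T = {x : some open edge of F lies within 10L+5 of c_x}` would carry an open face-to-face path of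
  `Λ_n` missing `F`; hence `{not fine} ∪ T` is a block cutset, its fine sites lie in `T`, and each
  edge is within `10L+5` of at most `11³ ≤ 8000` centres.
Composition (kernel-checked, no `sorry`): for `8000 k < N` and `n ≥ 10L+4` the min-cut event
`{MC_n ≤ k}` is disjoint from `RichCutsets` on lattice configurations, so each of the first
`min(N/8000, (2n+1)²)` layer-cake terms is `≥ 1/2`; arithmetic gives `c' n² − C n`.

DISPROOF USED: none exists (new crux). The statement is a theorem-schema valid at every `p`
(at `p = 1` the hypotheses hold for every `L` and the conclusion reads `c n² − C n ≤ (2n+1)²`).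
-/

noncomputable section

namespace Summit.CriticalPhenomena.PercolationContinuityZ3.Cruxes.FluxFromGoodBlocks.BlockCutsetDuality

open MeasureTheory Filter Literature.Probability.Percolation Literature.Probability.LatticeModels
open scoped Topology

/-! ## Objects of the line -/

/-- The bond percolation measure on `ℤ³` at parameter `p`. -/
abbrev μ (p : unitInterval) : Measure (BondConfig (Site 3)) := bondPercolation (zdGraph 3) p

/-- The min-cut event `{MC_n ≤ k}` of the route (verbatim): some edge set with `≤ k` open edges meets
every open path of `Λ_n` from `{x₀ = −n}` to `{x₀ = n}`. -/
def cutEvent (n k : ℕ) : Set (BondConfig (Site 3)) :=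
  {ω | ∃ F : Finset (Sym2 (Site 3)), ((↑F : Set (Sym2 (Site 3))) ∩ ω).ncard ≤ k ∧
    ∀ x ∈ box 3 n, ∀ y ∈ box 3 n, x 0 = -(n : ℤ) → y 0 = (n : ℤ) → ω \ ↑F ∉ openConnIn ↑(box 3 n) x y}

/-- (h1)-event: no vertex of the core `Λ_L` percolates. -/
def NoPerc (L : ℕ) : Set (BondConfig (Site 3)) := {ω | ∀ w ∈ box 3 L, ω ∉ percolatesAt w}

/-- (h2)-event at scale `M`: two arms `Λ_M → ∂Λ_{2M}` (inside `Λ_{2M}`) in different clusters of `Λ_{2M-1}`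
(graph-free, verbatim the hypothesis event of the crux; = `⋃ twoArm (2M) u v` on lattice configurations). -/
def TwoArms (M : ℕ) : Set (BondConfig (Site 3)) :=
  {ω | ∃ u ∈ box 3 M, ∃ v ∈ box 3 M, (∃ y ∈ innerBoundary (zdGraph 3) (box 3 (2 * M)), ω ∈ openConnIn (↑(box 3 (2 * M)) : Set (Site 3)) u y) ∧
    (∃ y ∈ innerBoundary (zdGraph 3) (box 3 (2 * M)), ω ∈ openConnIn (↑(box 3 (2 * M)) : Set (Site 3)) v y) ∧
    ω ∉ openConnIn (↑(box 3 (2 * M - 1)) : Set (Site 3)) u v}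

/-- Centre of the renormalised site `x` at scale `L`: `c_x = (2L+1) x`. -/
def centre (L : ℕ) (x : Site 3) : Site 3 := (2 * (L : ℤ) + 1) • x

/-- The shifted box `c + Λ_R`. -/
def sbox (c : Site 3) (R : ℕ) : Set (Site 3) := {y | y - c ∈ box 3 R}

/-- Arm around the centre `c`: `w ↔ ∂(c + Λ_R)` (the translate of `boxArm R`). -/
def ArmAt (c : Site 3) (R : ℕ) (w : Site 3) : Set (BondConfig (Site 3)) :=
  {ω | ∃ u : Site 3, u ∉ sbox c (R - 1) ∧ ∃ u' ∈ sbox c (R - 1),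
    (openGraph ω ⊓ zdGraph 3).Adj u' u ∧ ω ∈ inConn (sbox c (R - 1)) w u'}

/-- Two arms around the centre `c` (the translate of `twoArm R u v`). -/
def TwoArmAt (c : Site 3) (R : ℕ) (u v : Site 3) : Set (BondConfig (Site 3)) :=
  ArmAt c R u ∩ ArmAt c R v ∩ (inConn (sbox c (R - 1)) u v)ᶜ

/-- GOOD renormalised site: a core arm at radius `8L+3`, no two arms at radius `6L+2` from `c_x + Λ_{3L+1}`. -/
def GoodBlock (L : ℕ) (x : Site 3) : Set (BondConfig (Site 3)) :=
  {ω | (∃ w ∈ sbox (centre L x) L, ω ∈ ArmAt (centre L x) (8 * L + 3) w) ∧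
    ∀ u ∈ sbox (centre L x) (3 * L + 1), ∀ v ∈ sbox (centre L x) (3 * L + 1),
      ω ∉ TwoArmAt (centre L x) (6 * L + 2) u v}

/-- Radius of the block box fitted into `Λ_n`: all windows `c_x + Λ_{8L+3}`, `x ∈ Λ_m`, lie in `Λ_n`. -/
def brad (L n : ℕ) : ℕ := (n - (8 * L + 3)) / (2 * L + 1)

/-- Face link of a boundary-layer site: a core vertex joined to the face `{y₀ = s}` of `Λ_n`
inside `Λ_n ∩ (c_x + Λ_{10L+4})`. -/
def FaceLink (L n : ℕ) (x : Site 3) (s : ℤ) : Set (BondConfig (Site 3)) :=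
  {ω | ∃ w ∈ sbox (centre L x) L, ∃ y : Site 3, y 0 = s ∧
    ω ∈ openConnIn ((↑(box 3 n) : Set (Site 3)) ∩ sbox (centre L x) (10 * L + 4)) w y}

/-- FINE site: good, and face-linked if it lies in an extreme layer of the block box. -/
def Fine (L n : ℕ) (x : Site 3) : Set (BondConfig (Site 3)) :=
  {ω | ω ∈ GoodBlock L x ∧ (x 0 = -(brad L n : ℤ) → ω ∈ FaceLink L n x (-(n : ℤ))) ∧
    (x 0 = (brad L n : ℤ) → ω ∈ FaceLink L n x (n : ℤ))}

/-- Block cutset of `Λ_m`: meets every lattice walk of `Λ_m` from `{x₀ = −m}` to `{x₀ = m}`. -/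
def IsBlockCutset (m : ℕ) (W : Set (Site 3)) : Prop :=
  ∀ (a b : Site 3) (P : (zdGraph 3).Walk a b), a 0 = -(m : ℤ) → b 0 = (m : ℤ) →
    (∀ x ∈ P.support, x ∈ box 3 m) → ∃ x ∈ P.support, x ∈ W

/-- STUB-1 event: every block cutset contains at least `N` fine sites. -/
def RichCutsets (L n N : ℕ) : Set (BondConfig (Site 3)) :=
  {ω | ∀ W : Finset (Site 3), IsBlockCutset (brad L n) ↑W → N ≤ Set.ncard {x : Site 3 | x ∈ W ∧ ω ∈ Fine L n x}}

/-- STUB 1 statement (the renormalisation proper, p-uniform). -/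
def RichCutsetsLikely : Prop :=
  ∃ ε₀ : ℝ, 0 < ε₀ ∧ ∀ L : ℕ, 1 ≤ L → ∃ c : ℝ, 0 < c ∧ ∃ n₀ : ℕ, ∀ p : unitInterval,
    (μ p).real (NoPerc L) ≤ ε₀ → (μ p).real (TwoArms (3 * L + 1)) ≤ ε₀ →
      ∀ n : ℕ, n₀ ≤ n → (μ p).real (RichCutsets L n ⌈c * (n : ℝ) ^ 2⌉₊)ᶜ ≤ 1 / 2

/-- STUB 2 statement (deterministic gluing and double counting). -/
def CutsetTransfer : Prop :=
  ∀ L n N : ℕ, 1 ≤ L → 10 * L + 4 ≤ n → ∀ ω : BondConfig (Site 3), ω ⊆ (zdGraph 3).edgeSet → ω ∈ RichCutsets L n N →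
    ∀ F : Finset (Sym2 (Site 3)),
      (∀ x ∈ box 3 n, ∀ y ∈ box 3 n, x 0 = -(n : ℤ) → y 0 = (n : ℤ) → ω \ ↑F ∉ openConnIn ↑(box 3 n) x y) →
      N ≤ 8000 * ((↑F : Set (Sym2 (Site 3))) ∩ ω).ncard


/-- Stand-in for the route decl `Theses.PercFluxFromDensity.FluxFromGoodBlocks` (item filed 2026-08-17; body VERBATIM the route decl's,
so the two are defeq by `Iff.rfl`/delta). Used as the composition's conclusion while the farm's olean of the route module
predates the item; the strategist re-points the composition at the route decl as soon as the module is rebuilt. -/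
def FluxFromGoodBlocksStmt : Prop :=
  ∃ ε₀ : ℝ, 0 < ε₀ ∧ ∀ L : ℕ, 1 ≤ L → ∃ c C : ℝ, 0 < c ∧ ∀ p : unitInterval, (Literature.Probability.Percolation.bondPercolation (Literature.Probability.LatticeModels.zdGraph 3) p).real {ω | ∀ w ∈ Literature.Probability.LatticeModels.box 3 L, ω ∉ Literature.Probability.Percolation.percolatesAt w} ≤ ε₀ → (Literature.Probability.Percolation.bondPercolation (Literature.Probability.LatticeModels.zdGraph 3) p).real {ω | ∃ u ∈ Literature.Probability.LatticeModels.box 3 (3 * L + 1), ∃ v ∈ Literature.Probability.LatticeModels.box 3 (3 * L + 1), (∃ y ∈ Literature.Probability.LatticeModels.innerBoundary (Literature.Probability.LatticeModels.zdGraph 3) (Literature.Probability.LatticeModels.box 3 (2 * (3 * L + 1))), ω ∈ Literature.Probability.Percolation.openConnIn ↑(Literature.Probability.LatticeModels.box 3 (2 * (3 * L + 1))) u y) ∧ (∃ y ∈ Literature.Probability.LatticeModels.innerBoundary (Literature.Probability.LatticeModels.zdGraph 3) (Literature.Probability.LatticeModels.box 3 (2 * (3 * L + 1))), ω ∈ Literature.Probability.Percolation.openConnIn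 ↑(Literature.Probability.LatticeModels.box 3 (2 * (3 * L + 1))) v y) ∧ ω ∉ Literature.Probability.Percolation.openConnIn ↑(Literature.Probability.LatticeModels.box 3 (2 * (3 * L + 1) - 1)) u v} ≤ ε₀ → ∀ n : ℕ, c * (n : ℝ) ^ 2 - C * n ≤ ∑ k ∈ Finset.range ((2 * n + 1) ^ 2), (1 - (Literature.Probability.Percolation.bondPercolation (Literature.Probability.LatticeModels.zdGraph 3) p).real {ω | ∃ F : Finset (Sym2 (Literature.Probability.LatticeModels.Site 3)), ((↑F : Set (Sym2 (Literature.Probability.LatticeModels.Site 3))) ∩ ω).ncard ≤ k ∧ ∀ x ∈ Literature.Probability.LatticeModels.box 3 n, ∀ y ∈ Literature.Probability.LatticeModels.box 3 n, x 0 = -(n : ℤ) → y 0 = (n : ℤ) → ω \ ↑F ∉ Literature.Probability.Percolation.openConnIn ↑(Literature.Probability.LatticeModels.box 3 n) x y})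

/-! ## Registered stubs -/

/-- STUB 1 **`richCutsets`**: under (h1), (h2) with an absolute `ε₀`, for `n ≥ n₀(L)`, with
probability `≥ 1/2` every block cutset of the fitted block box contains `≥ ⌈c(L) n²⌉` fine sites. -/
theorem stub_richCutsets : RichCutsetsLikely := by
  sorry

/-- STUB 2 **`cutsetTransfer`**: on lattice configurations and once the block box is non-degenerate
(`n ≥ 10L+4`, so `brad ≥ 1`), rich block cutsets force every open cutset of `Λ_n` between the faces to
contain `≥ N/8000` open edges. (For `n < 6L+2` the transfer fails: all edges of `Λ_1` closed, everything
else open is in `RichCutsets L 1 1` with the empty cutset.) -/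
theorem stub_cutsetTransfer : CutsetTransfer := by
  sorry

namespace Registered
/-- registered stub signature (the hypothesis type of the composition, by name) -/
abbrev stub_richCutsets : Prop := RichCutsetsLikely
/-- registered stub signature -/
abbrev stub_cutsetTransfer : Prop := CutsetTransfer
end Registered


/-! ## Sanity of the definitions (the block box itself is a block cutset; `N = 0` is free) -/

/-- The whole block box is a block cutset (so `RichCutsets` is never vacuously true for `N ≥ 1`
because of a lack of cutsets). [folklore] -/
theorem isBlockCutset_box (m : ℕ) : IsBlockCutset m (↑(box 3 m) : Set (Site 3)) := by
  intro a b P _ _ hP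
  exact ⟨a, P.start_mem_support, hP a P.start_mem_support⟩

/-- With `N = 0` every configuration has rich cutsets. [folklore] -/
theorem richCutsets_zero (L n : ℕ) : RichCutsets L n 0 = Set.univ := by
  ext ω
  simp [RichCutsets]

/-! ## Composition (no `sorry` below this line) -/

/-- A cheap min-cut contradicts rich block cutsets: for `8000 k < N`, `{MC_n ≤ k}` misses
`RichCutsets L n N` on lattice configurations, hence in probability. [folklore] -/
theorem real_cutEvent_le (h₂ : CutsetTransfer) {L : ℕ} (hL : 1 ≤ L) (p : unitInterval) {n : ℕ} (hn : 10 * L + 4 ≤ n)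
    (N k : ℕ) (hk : 8000 * k < N) :
    (μ p).real (cutEvent n k) ≤ (μ p).real (RichCutsets L n N)ᶜ := by
  refine DCT16.real_mono_of_forall_subset_edgeSet (zdGraph 3) p fun ω hω hmem => ?_
  intro hrich
  obtain ⟨F, hFk, hFcut⟩ := hmem
  have h := h₂ L n N hL hn ω hω hrich F hFcut
  have : 8000 * ((↑F : Set (Sym2 (Site 3))) ∩ ω).ncard ≤ 8000 * k := Nat.mul_le_mul_left _ hFk
  omega

/-- Integer division loses less than one: `↑(N / 8000) ≥ N/8000 − 1` in `ℝ`. [folklore] -/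
theorem cast_div_ge (N : ℕ) : (N : ℝ) / 8000 - 1 ≤ ((N / 8000 : ℕ) : ℝ) := by
  have h := Nat.div_add_mod N 8000
  have hlt := Nat.mod_lt N (by norm_num : 0 < 8000)
  have hcast : (8000 : ℝ) * ((N / 8000 : ℕ) : ℝ) + ((N % 8000 : ℕ) : ℝ) = (N : ℝ) := by
    exact_mod_cast h
  have hlt' : ((N % 8000 : ℕ) : ℝ) < 8000 := by exact_mod_cast hlt
  linarith

/-- **Composition**: STUB 1 → STUB 2 → the crux `FluxFromGoodBlocks` (concluded BY NAME). [folklore] -/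
theorem FluxFromGoodBlocks_of (h₁ : Registered.stub_richCutsets) (h₂ : Registered.stub_cutsetTransfer) :
    FluxFromGoodBlocksStmt := by
  obtain ⟨ε₀, hε₀, H⟩ := h₁
  refine ⟨ε₀, hε₀, fun L hL => ?_⟩
  obtain ⟨c, hc, n₀, Hc⟩ := H L hL
  set c' : ℝ := min (c / 8000) 4 / 2 with hc'
  have hc'pos : 0 < c' := by positivity
  set n₁ : ℕ := max n₀ (10 * L + 4) with hn₁
  refine ⟨c', max (1 / 2) (c' * n₁), hc'pos, fun p h1 h2 n => ?_⟩
  -- the layer-cake sum is the sum of `1 - P(cutEvent n k)`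
  change c' * (n : ℝ) ^ 2 - max (1 / 2) (c' * n₁) * n ≤
    ∑ k ∈ Finset.range ((2 * n + 1) ^ 2), (1 - (μ p).real (cutEvent n k))
  have hterm_nonneg : ∀ k, 0 ≤ 1 - (μ p).real (cutEvent n k) := fun k => by
    linarith [measureReal_le_one (μ := μ p) (s := cutEvent n k)]
  have hsum_nonneg : 0 ≤ ∑ k ∈ Finset.range ((2 * n + 1) ^ 2), (1 - (μ p).real (cutEvent n k)) :=
    Finset.sum_nonneg fun k _ => hterm_nonneg k
  by_cases hn : n₁ ≤ n
  · -- main case `n ≥ max n₀ 1`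
    have hn₀ : n₀ ≤ n := le_trans (le_max_left _ _) hn
    have hn10 : 10 * L + 4 ≤ n := le_trans (le_max_right _ _) hn
    have hn1 : (1 : ℝ) ≤ n := by exact_mod_cast (show 1 ≤ n by omega)
    set N : ℕ := ⌈c * (n : ℝ) ^ 2⌉₊ with hN
    have hrich : (μ p).real (RichCutsets L n N)ᶜ ≤ 1 / 2 := Hc p h1 h2 n hn₀
    set K : ℕ := min (N / 8000) ((2 * n + 1) ^ 2) with hK
    -- each of the first `K` terms is at least `1/2`
    have hterm : ∀ k ∈ Finset.range K, (1 / 2 : ℝ) ≤ 1 - (μ p).real (cutEvent n k) := by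
      intro k hk
      rw [Finset.mem_range] at hk
      have hk1 : k < N / 8000 := lt_of_lt_of_le hk (min_le_left _ _)
      have hk2 : (k + 1) * 8000 ≤ N := (Nat.le_div_iff_mul_le (by norm_num)).1 hk1
      have hk3 : 8000 * k < N := by omega
      have := real_cutEvent_le h₂ hL p hn10 N k hk3
      linarith
    have hKT : Finset.range K ⊆ Finset.range ((2 * n + 1) ^ 2) :=
      Finset.range_mono (min_le_right _ _)
    have hsum1 : ∑ k ∈ Finset.range K, (1 - (μ p).real (cutEvent n k)) ≤
        ∑ k ∈ Finset.range ((2 * n + 1) ^ 2), (1 - (μ p).real (cutEvent n k)) :=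
      Finset.sum_le_sum_of_subset_of_nonneg hKT fun k _ _ => hterm_nonneg k
    have hsum2 : (K : ℝ) * (1 / 2) ≤ ∑ k ∈ Finset.range K, (1 - (μ p).real (cutEvent n k)) := by
      have := Finset.card_nsmul_le_sum (Finset.range K) (fun k => 1 - (μ p).real (cutEvent n k)) (1 / 2) hterm
      rwa [Finset.card_range, nsmul_eq_mul] at this
    -- `K/2 ≥ c' n² − 1/2`
    have hNge : c * (n : ℝ) ^ 2 ≤ (N : ℝ) := Nat.le_ceil _
    have hdiv : (N : ℝ) / 8000 - 1 ≤ ((N / 8000 : ℕ) : ℝ) := cast_div_ge N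
    have hsq : (4 : ℝ) * (n : ℝ) ^ 2 ≤ (((2 * n + 1) ^ 2 : ℕ) : ℝ) := by
      push_cast; nlinarith
    have hKge : min (c / 8000) 4 * (n : ℝ) ^ 2 - 1 ≤ (K : ℝ) := by
      have hn2 : (0 : ℝ) ≤ (n : ℝ) ^ 2 := by positivity
      rw [hK, Nat.cast_min]
      refine le_min ?_ ?_
      · have : min (c / 8000) 4 * (n : ℝ) ^ 2 ≤ c / 8000 * (n : ℝ) ^ 2 :=
          mul_le_mul_of_nonneg_right (min_le_left _ _) hn2
        linarith
      · have : min (c / 8000) 4 * (n : ℝ) ^ 2 ≤ 4 * (n : ℝ) ^ 2 :=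
          mul_le_mul_of_nonneg_right (min_le_right _ _) hn2
        linarith
    have hC : (1 / 2 : ℝ) ≤ max (1 / 2) (c' * n₁) * n := by
      have : (1 / 2 : ℝ) ≤ max (1 / 2) (c' * n₁) := le_max_left _ _
      nlinarith
    have hc'eq : c' * (n : ℝ) ^ 2 = (min (c / 8000) 4 * (n : ℝ) ^ 2) / 2 := by rw [hc']; ring
    linarith
  · -- small `n`: the left side is `≤ 0`
    push Not at hn
    have hnle : (n : ℝ) ≤ n₁ := by exact_mod_cast hn.le
    have hn0 : (0 : ℝ) ≤ n := by positivity
    have h1' : c' * (n : ℝ) ^ 2 ≤ max (1 / 2) (c' * n₁) * n := by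
      calc c' * (n : ℝ) ^ 2 = (c' * n) * n := by ring
        _ ≤ (c' * n₁) * n := by
          apply mul_le_mul_of_nonneg_right _ hn0
          exact mul_le_mul_of_nonneg_left hnle hc'pos.le
        _ ≤ max (1 / 2) (c' * n₁) * n := mul_le_mul_of_nonneg_right (le_max_right _ _) hn0
    linarith

end Summit.CriticalPhenomena.PercolationContinuityZ3.Cruxes.FluxFromGoodBlocks.BlockCutsetDuality

end
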